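import Summits.QuantumFields.BalabanUV.Beta.CovariantKato

/-!
# `Summit.QuantumFields.BalabanUV.Beta.GraphComparison` — engine file 14: the discrete MAXIMUM ∕ COMPARISON PRINCIPLE for the free
# weighted graph Laplacian with exterior data and a STRICT supersolution margin (generic finite bond structure), and its combination
# with Kato (file 12): the fibre norm of a solution of `D*Df = g` is dominated on `B` by ANY strict free supersolution with source
# `‖g‖` that dominates it off `B` — the tool that turns item (K) into pointwise bounds once a supersolution is exhibited (item (DS)
# of the owner's decomposition E-an4-141a of O.2 item (ii-b))

HONEST FRAMING (page 1 of everything in this cell).  Discharging `FlowStep.BetaPertH` would make Bałaban's ultraviolet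
stability UNCONDITIONAL — a constructive-QFT result; it is NOT the continuum limit and NOT the Clay problem.  This module
discharges nothing of `BetaPertH`; it is [folklore] finite-dimensional order bookkeeping (a maximum argument), kernel-checked, by the
OWNER of binder row D4 (unit `b2b-balaban-beta-an4`, gen 44).  HONEST DEPENDENCY: continuum YM on T⁴ ⇐ BetaPertH ∧ nine spine
estimates (0/9 proved); BetaPertH ⇐ (D1) ∧ (D4) ∧ CAP+tail; G-an2-4 gates asym, D1 and NE2/3/4.

WHAT IS CERTIFIED (kernel, 0 sorry), on any finite bond structure `src, tgt : Bd → St` with bond weights `c` (writing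
`W(x) = Σ_{b : tgt b = x} c_b² + Σ_{b : src b = x} c_b²` and `(Nv)(x) = Σ_{b : tgt b = x} c_b²·v(src b) + Σ_{b : src b = x} c_b²·v(tgt b)`):
* **`nonpos_of_strict_subsolution`** — if `W(x)·v(x) + η ≤ (Nv)(x)` for every `x ∈ B` with `η > 0`, and `v ≤ 0` off `B`, then `v ≤ 0`
  everywhere (a positive maximum would sit in `B` and violate the inequality — no connectivity hypothesis thanks to the margin);
* **`le_of_comparison`** — a sub-solution `u` (`W·u ≤ Nu + s` on `B`) is dominated by a STRICT supersolution `w`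
  (`Nw + s + η ≤ W·w` on `B`, `η > 0`) with `u ≤ w` off `B`: `u ≤ w` everywhere;
* **`fibreNorm_le_of_supersolution`** — with file 12's `kato_covLap`: for column-orthonormal bond matrices and any `f`, the fibre norm
  `x ↦ √(Σ_i f(x,i)²)` is dominated on `B` by every strict free supersolution `w` with source `√(Σ_i ((D*Df)(x,i))²)` that dominates
  it off `B`.
NOT here: the supersolution itself on a lattice ball (item (DS): `(r² − |x − x₀|²)/(2d)`-type, `Δ_{ℤ^d}|x|² = 2d`), the mean-value
inequality (MV).  Row D4: NO class change (critical-path width 0; D4 DISCHARGE NO DATE); NOT BetaPertH, NOT continuum, NOT Clay,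
NOT summit progress.  LOCATORS (shape only; ABSOLUTE RULE): [Balaban1985BackgroundPropagators] (3.23) p. 394; [Balaban1984PropagatorsI]
p. 36 (the maximum-principle flavour of the lattice arguments; nothing quoted).
-/

open scoped BigOperators
open Finset

namespace Summit.QuantumFields.BalabanUV.Beta.GraphComparison

open Summit.QuantumFields.BalabanUV.Beta.CovariantKato (kato_covLap)
open Literature.MathematicalPhysics.QuantumFieldTheory.Balaban1983to89
open Literature.MathematicalPhysics.QuantumFieldTheory.Balaban1983to89.B9Thm37Glue (covD covDT)

noncomputable section

variable {St Bd : Type} [Fintype St] [Fintype Bd] [DecidableEq St] (src tgt : Bd → St) (c : Bd → ℝ)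

/-- **THE MAXIMUM PRINCIPLE WITH A STRICT MARGIN.**  If `W(x)·v(x) + η ≤ Σ_{tgt b = x} c_b²·v(src b) + Σ_{src b = x} c_b²·v(tgt b)` for
every `x ∈ B` with `η > 0`, and `v(x) ≤ 0` for `x ∉ B`, then `v ≤ 0` everywhere. [folklore] -/
theorem nonpos_of_strict_subsolution (B : Finset St) (v : St → ℝ) {η : ℝ} (hη : 0 < η)
    (hsub : ∀ x ∈ B, ((∑ b ∈ univ.filter (fun b => tgt b = x), c b ^ 2) + ∑ b ∈ univ.filter (fun b => src b = x), c b ^ 2) * v x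
      + η ≤ (∑ b ∈ univ.filter (fun b => tgt b = x), c b ^ 2 * v (src b)) + ∑ b ∈ univ.filter (fun b => src b = x), c b ^ 2 * v (tgt b))
    (hout : ∀ x, x ∉ B → v x ≤ 0) (x : St) : v x ≤ 0 := by
  classical
  -- a maximiser of `v` over all sites
  obtain ⟨x₀, -, hx₀⟩ := Finset.exists_max_image (Finset.univ : Finset St) v ⟨x, mem_univ x⟩
  by_cases hpos : v x₀ ≤ 0
  · exact (hx₀ x (mem_univ x)).trans hpos
  · exfalso
    have hvpos : 0 < v x₀ := lt_of_not_ge hpos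
    have hxB : x₀ ∈ B := by
      by_contra h
      exact hpos (hout x₀ h)
    have h := hsub x₀ hxB
    -- every neighbour value is `≤ v x₀`
    have hT : ∑ b ∈ univ.filter (fun b => tgt b = x₀), c b ^ 2 * v (src b) ≤
        (∑ b ∈ univ.filter (fun b => tgt b = x₀), c b ^ 2) * v x₀ := by
      rw [Finset.sum_mul]
      exact Finset.sum_le_sum fun b _ => mul_le_mul_of_nonneg_left (hx₀ _ (mem_univ _)) (sq_nonneg _)
    have hS : ∑ b ∈ univ.filter (fun b => src b = x₀), c b ^ 2 * v (tgt b) ≤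
        (∑ b ∈ univ.filter (fun b => src b = x₀), c b ^ 2) * v x₀ := by
      rw [Finset.sum_mul]
      exact Finset.sum_le_sum fun b _ => mul_le_mul_of_nonneg_left (hx₀ _ (mem_univ _)) (sq_nonneg _)
    linarith

/-- **THE COMPARISON PRINCIPLE.**  A sub-solution `u` of the free weighted graph Laplacian with source `s` on `B`
(`W(x)·u(x) ≤ (Nu)(x) + s(x)`) is dominated by every STRICT supersolution `w` (`(Nw)(x) + s(x) + η ≤ W(x)·w(x)`, `η > 0`) with
`u ≤ w` off `B`: `u(x) ≤ w(x)` for every `x`. [folklore] -/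
theorem le_of_comparison (B : Finset St) (u w s : St → ℝ) {η : ℝ} (hη : 0 < η)
    (hsub : ∀ x ∈ B, ((∑ b ∈ univ.filter (fun b => tgt b = x), c b ^ 2) + ∑ b ∈ univ.filter (fun b => src b = x), c b ^ 2) * u x
      ≤ (∑ b ∈ univ.filter (fun b => tgt b = x), c b ^ 2 * u (src b)) + (∑ b ∈ univ.filter (fun b => src b = x), c b ^ 2 * u (tgt b))
        + s x)
    (hsuper : ∀ x ∈ B, (∑ b ∈ univ.filter (fun b => tgt b = x), c b ^ 2 * w (src b)) +
      (∑ b ∈ univ.filter (fun b => src b = x), c b ^ 2 * w (tgt b)) + s x + η ≤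
      ((∑ b ∈ univ.filter (fun b => tgt b = x), c b ^ 2) + ∑ b ∈ univ.filter (fun b => src b = x), c b ^ 2) * w x)
    (hout : ∀ x, x ∉ B → u x ≤ w x) (x : St) : u x ≤ w x := by
  have h := nonpos_of_strict_subsolution src tgt c B (fun y => u y - w y) hη (fun y hy => ?_)
    (fun y hy => sub_nonpos.mpr (hout y hy)) x
  · exact sub_nonpos.mp h
  · have h1 := hsub y hy
    have h2 := hsuper y hy
    have hTs : ∑ b ∈ univ.filter (fun b => tgt b = y), c b ^ 2 * (u (src b) - w (src b)) =
        (∑ b ∈ univ.filter (fun b => tgt b = y), c b ^ 2 * u (src b)) - ∑ b ∈ univ.filter (fun b => tgt b = y), c b ^ 2 * w (src b) := by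
      rw [← Finset.sum_sub_distrib]; exact Finset.sum_congr rfl fun b _ => by ring
    have hSs : ∑ b ∈ univ.filter (fun b => src b = y), c b ^ 2 * (u (tgt b) - w (tgt b)) =
        (∑ b ∈ univ.filter (fun b => src b = y), c b ^ 2 * u (tgt b)) - ∑ b ∈ univ.filter (fun b => src b = y), c b ^ 2 * w (tgt b) := by
      rw [← Finset.sum_sub_distrib]; exact Finset.sum_congr rfl fun b _ => by ring
    rw [hTs, hSs, mul_sub]
    linarith

/-- **KATO + COMPARISON.**  For column-orthonormal bond matrices `Rm` and any field `f`, write `g = D*Df` (`D*D = covDT ∘ covD`).  If `w`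
is a STRICT free supersolution on `B` with source the fibre norm of `g` — `(Nw)(x) + √(Σ_i g(x,i)²) + η ≤ W(x)·w(x)` for `x ∈ B`, `η > 0`
— and `√(Σ_i f(x,i)²) ≤ w(x)` off `B`, then `√(Σ_i f(x,i)²) ≤ w(x)` for every `x`: the pointwise bound of item (K)+(DS), modulo
exhibiting `w`. [cite: Balaban1985BackgroundPropagators, (3.23) p.394] [folklore] -/
theorem fibreNorm_le_of_supersolution {Cp : Type} [Fintype Cp] [DecidableEq Cp] (Rm : Bd → Cp → Cp → ℝ)
    (hRm : ∀ b i j, ∑ k, Rm b k i * Rm b k j = if i = j then (1 : ℝ) else 0) (f : St × Cp → ℝ)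
    (B : Finset St) (w : St → ℝ) {η : ℝ} (hη : 0 < η)
    (hsuper : ∀ x ∈ B, (∑ b ∈ univ.filter (fun b => tgt b = x), c b ^ 2 * w (src b)) +
      (∑ b ∈ univ.filter (fun b => src b = x), c b ^ 2 * w (tgt b)) +
      Real.sqrt (∑ i, (covDT src tgt c Rm (covD src tgt c Rm f) (x, i)) ^ 2) + η ≤
      ((∑ b ∈ univ.filter (fun b => tgt b = x), c b ^ 2) + ∑ b ∈ univ.filter (fun b => src b = x), c b ^ 2) * w x)
    (hout : ∀ x, x ∉ B → Real.sqrt (∑ i, f (x, i) ^ 2) ≤ w x) (x : St) :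
    Real.sqrt (∑ i, f (x, i) ^ 2) ≤ w x :=
  le_of_comparison src tgt c B (fun y => Real.sqrt (∑ i, f (y, i) ^ 2)) w
    (fun y => Real.sqrt (∑ i, (covDT src tgt c Rm (covD src tgt c Rm f) (y, i)) ^ 2)) hη
    (fun y _ => by
      have h := kato_covLap src tgt c Rm hRm f y
      linarith)
    hsuper hout x

end

end Summit.QuantumFields.BalabanUV.Beta.GraphComparison
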